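import Summits.QuantumFields.BalabanUV.Beta.GAN24.AliasDecimate
import Summits.QuantumFields.BalabanUV.Beta.GAN24.PushSumNest
import Summits.QuantumFields.BalabanUV.Beta.GAN24.FibreSymbols

/-!
# `BalabanUV.Beta.GAN24.PushSumSymbol` — binder row G-an2-4 / (CONV-C), S-slot road «S3», THE SYMBOL OF ONE PUSH (typer cut R6-symbol;
# `SKELETON-S3.md` I-L3 `pushSum_symbol`): a multiplier leg of an2's `pushSum M L K` read at a point of the new coarse lattice is the real
# part of the COARSE lattice kernel of the PUSHED SYMBOL `pushSym L μ t G (P) = (L^{d+1})⁻¹ Σ_l e^{i k_l·t} · cweight L μ (k_l) · G(k_l)`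

NOT IN PRINT; OUR PROOF ATTEMPT (of the road; THIS file is [folklore] bookkeeping: this lineage's `PushSumNest.pushSum_inr_inl_coarse`
(push = straight-contour sum on the `M`-lattice) + `AliasDecimate.latticeKernel_sum_decimate` (offset sums of a fine kernel over one block =
ONE coarse kernel) + road P1's `FibreSymbols.contourSum_plane` (the contour weight `(Π_i gsum (k_i) L)·gsum (k_μ) L`); no estimate, no cited
fact, no `def … : Prop`, no wall binder).  G-an2-4 formalisation swarm, leaf prover 17 (unit `b2b-balaban-gan24-formalise-leaf-17`, gen 11),
the holder of E3 `PushSumNest`, E8 `AliasNest`, «ALIAS-DECIMATE*» (`AliasTiling` p205937, `AliasDecimate`); row owner gan24-p1-g4 RULINGS-6: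
«the Fourier face of `pushSum`∕decimation; consumers: «E3SupRate»'s fibre road and leaf-16's (N1-Cauchy)».  HONEST FRAMING (cell contract,
verbatim): «discharging `BetaPertH` makes Bałaban's UV stability UNCONDITIONAL — a real constructive-QFT result; it is NOT the continuum limit
and NOT the Clay problem.»  HONEST DEPENDENCY (verbatim): «continuum YM on T⁴ ⇐ BetaPertH ∧ nine spine estimates (0/9 proved); BetaPertH ⇐
(D1) ∧ (D4) ∧ CAP+tail; G-an2-4 gates asym, D1 and NE2/3/4.»  NOT summit progress; nothing of (CONV-C)'s S-slot («E3Shape» ∕ «E3SupRate»,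
OPEN, not in print) is discharged here.

## What is proved ([folklore], `0 sorry`; generic `d`; `L ≥ 1`)
* §1 `cphase_eq_pw` (an3∕pv17's character = road P1's plane wave, `rfl`), `cweight L μ k := (Π_i gsum (k_i) L)·gsum (k_μ) L`,
  **`sum_cphase_contour`**: `Σ_{b ∈ box L} Σ_{s<L} e^{i k·(b + s e_μ + t)} = e^{i k·t}·cweight L μ k`.
* §2 **`pushSym L μ t G`**, `sum_aliasSym_contour` (the contour sum of the aliased symbols IS the pushed symbol),
  **`contourSum_latticeKernel`**: `contourSum L (ν y ↦ latticeKernel (G ν) (y + t)) μ z = latticeKernel (pushSym L μ t (G μ)) z` for `G ν`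
  globally `2π`-periodic and continuous on the real zone; `contourSum_re_latticeKernel` (real-part readings).
* §3 **`pushSum_inr_inl_symbol`** ∕ **`pushSum_inl_inr_symbol`**: if the multiplier leg of `K` on the `M`-lattice against a fixed second leg
  reads `K (M•y) w (inr ν) (inl β) = Re latticeKernel (G ν) (y + t)` (the shape of `CombesThomasFibre.KInv_eq_re_latticeKernel`), then
  `pushSum M L K ((M·L)•z) w (inr μ) (inl β) = Re latticeKernel (pushSym L μ t (G μ)) z` — and the transposed entry.
WHAT IS NOT HERE: the multiplier–multiplier entry (double contour sum `pushSum_inr_inr_coarse`: the same computation on the JOINT symbol at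
dimension `(d+1)+(d+1)`, leaf-14's `latticeKernel₂` currency — when a consumer asks); strip regularity of `pushSym` (see `AliasDecimate`'s
header: needs full-strip regularity of `G`); any located object (`Sc`, `vertexOf`, `e3Of`).
-/

noncomputable section

open Complex Finset
open scoped Real BigOperators
open Literature.MathematicalPhysics.QuantumFieldTheory
open Literature.MathematicalPhysics.QuantumFieldTheory.Balaban1983to89
open Literature.MathematicalPhysics.QuantumFieldTheory.Balaban1983to89.Beta
open B4Strip (ofRealVec)
open B4ContourShift (latticeKernel BZ)
open Beta.FibreInverseDecay (cphase)
open AffineAveraging (contourSum box toSite unitVec)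
open OneStepResolventKernel (Fib)
open BalabanCompositeJets (pushSum)
open Summit.QuantumFields.BalabanUV.Beta.GAN24.FibreSymbols (pw gsum pw1 contourSum_plane pw_add)
open Summit.QuantumFields.BalabanUV.Beta.GAN24.AliasDecimate (aliasPt aliasSym latticeKernel_sum_decimate latticeKernel_decimate)
open Summit.QuantumFields.BalabanUV.Beta.GAN24.PushSumNest (pushSum_inr_inl_coarse pushSum_inl_inr_coarse)

namespace Summit.QuantumFields.BalabanUV.Beta.GAN24.PushSumSymbol

variable {d : ℕ} (L : ℕ)

/-! ## §1 The contour weight: the straight-contour sum of a plane wave -/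

/-- [folklore] an3/pv17's character and road P1's plane wave are the same function: `cphase x k = pw k x`. -/
theorem cphase_eq_pw (x : Fin (d + 1) → ℤ) (k : Fin (d + 1) → ℂ) : cphase x k = pw k x := rfl

/-- [folklore] THE CONTOUR WEIGHT of the `L`-block in direction `μ` at the momentum `k`: `(Π_i gsum (k_i) L) · gsum (k_μ) L` — the symbol of
road P1's `contourSum` on plane waves (`FibreSymbols.contourSum_plane` at `y = 0`, `v = 1`). -/
def cweight (L : ℕ) (μ : Fin (d + 1)) (k : Fin (d + 1) → ℂ) : ℂ := (∏ i, gsum (k i) L) * gsum (k μ) L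

/-- [folklore] The straight-contour sum of the character: `Σ_{b ∈ box L} Σ_{s < L} e^{i k·(b + s e_μ + t)} = e^{i k·t} · cweight L μ k`. -/
theorem sum_cphase_contour (k : Fin (d + 1) → ℂ) (μ : Fin (d + 1)) (t : Fin (d + 1) → ℤ) :
    ∑ b ∈ box (d + 1) L, ∑ s ∈ Finset.range L, cphase (toSite b + (s : ℤ) • unitVec μ + t) k = cphase t k * cweight L μ k := by
  have h := contourSum_plane k (fun _ => (1 : ℂ)) L μ 0
  simp only [contourSum, pw1, one_mul, smul_zero, zero_add] at h
  rw [show pw k (0 : Fin (d + 1) → ℤ) = 1 by simp [pw]] at h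
  rw [one_mul] at h
  simp only [cphase_eq_pw, pw_add]
  rw [cweight, ← h, Finset.mul_sum]
  refine Finset.sum_congr rfl fun b _ => ?_
  rw [Finset.mul_sum]
  refine Finset.sum_congr rfl fun s _ => ?_
  rw [pw_add]
  ring

/-! ## §2 Contour sums of lattice-kernel readings are ONE coarse lattice kernel -/

/-- [folklore] THE PUSHED SYMBOL of `G` (blocking factor `L`, contour direction `μ`, fine offset `t`):
`pushSym L μ t G P = (L^{d+1})⁻¹ Σ_l e^{i k_l(P)·t} · cweight L μ (k_l P) · G (k_l P)` — alias average weighted by the contour weight. -/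
def pushSym (L : ℕ) (μ : Fin (d + 1)) (t : Fin (d + 1) → ℤ) (G : (Fin (d + 1) → ℂ) → ℂ) : (Fin (d + 1) → ℂ) → ℂ :=
  fun P => ((L : ℂ) ^ (d + 1))⁻¹ * ∑ l : Fin (d + 1) → Fin L, cphase t (aliasPt L l P) * cweight L μ (aliasPt L l P) * G (aliasPt L l P)

/-- [folklore] The sum of the aliased symbols over the contour offsets IS the pushed symbol. -/
theorem sum_aliasSym_contour (μ : Fin (d + 1)) (t : Fin (d + 1) → ℤ) (G : (Fin (d + 1) → ℂ) → ℂ) (P : Fin (d + 1) → ℂ) :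
    ∑ i ∈ box (d + 1) L ×ˢ Finset.range L, aliasSym L (toSite i.1 + (i.2 : ℤ) • unitVec μ + t) G P = pushSym L μ t G P := by
  simp only [aliasSym, pushSym]
  rw [← Finset.mul_sum]
  congr 1
  rw [Finset.sum_comm]
  refine Finset.sum_congr rfl fun l _ => ?_
  rw [← Finset.sum_mul, Finset.sum_product, sum_cphase_contour]

/-- [folklore] **A STRAIGHT-CONTOUR SUM OF LATTICE-KERNEL READINGS** over one `L`-block (with a fine offset `t`) is the coarse lattice kernel
of the pushed symbol: `contourSum L (ν y ↦ latticeKernel (G ν) (y + t)) μ z = latticeKernel (pushSym L μ t (G μ)) z`. -/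
theorem contourSum_latticeKernel [NeZero L] (G : Fin (d + 1) → (Fin (d + 1) → ℂ) → ℂ)
    (hper : ∀ ν (i : Fin (d + 1)) (P : Fin (d + 1) → ℂ), G ν (Function.update P i (P i + 2 * π)) = G ν P)
    (hcont : ∀ ν, Continuous fun p : Fin (d + 1) → ℝ => G ν (ofRealVec p)) (t : Fin (d + 1) → ℤ) (μ : Fin (d + 1))
    (z : Fin (d + 1) → ℤ) :
    contourSum L (fun ν y => latticeKernel (G ν) (y + t)) μ z = latticeKernel (pushSym L μ t (G μ)) z := by
  have h := latticeKernel_sum_decimate L (box (d + 1) L ×ˢ Finset.range L) (fun _ => (1 : ℂ))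
    (fun i => toSite i.1 + (i.2 : ℤ) • unitVec μ + t) (hper μ) (hcont μ) z
  simp only [one_mul] at h
  have e : (fun P => ∑ a ∈ box (d + 1) L ×ˢ Finset.range L, aliasSym L (toSite a.1 + (a.2 : ℤ) • unitVec μ + t) (G μ) P)
      = pushSym L μ t (G μ) := by
    funext P; exact sum_aliasSym_contour L μ t (G μ) P
  rw [e] at h
  rw [← h, contourSum, Finset.sum_product]
  refine Finset.sum_congr rfl fun b _ => Finset.sum_congr rfl fun s _ => ?_
  congr 1
  abel

/-- [folklore] The same for REAL-PART readings (road P1's kernels are real parts of lattice kernels). -/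
theorem contourSum_re_latticeKernel [NeZero L] (G : Fin (d + 1) → (Fin (d + 1) → ℂ) → ℂ)
    (hper : ∀ ν (i : Fin (d + 1)) (P : Fin (d + 1) → ℂ), G ν (Function.update P i (P i + 2 * π)) = G ν P)
    (hcont : ∀ ν, Continuous fun p : Fin (d + 1) → ℝ => G ν (ofRealVec p)) (t : Fin (d + 1) → ℤ) (μ : Fin (d + 1))
    (z : Fin (d + 1) → ℤ) :
    contourSum L (fun ν y => (latticeKernel (G ν) (y + t)).re) μ z = (latticeKernel (pushSym L μ t (G μ)) z).re := by
  rw [← contourSum_latticeKernel L G hper hcont t μ z]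
  simp only [contourSum, Complex.re_sum]

/-! ## §3 THE SYMBOL OF ONE PUSH of an2's `pushSum` (multiplier–field and field–multiplier entries) -/

variable {M : ℕ} [NeZero L] [NeZero (M * L)]

/-- [folklore] **THE SYMBOL OF ONE PUSH, multiplier–field entry**: if the multiplier leg of `K`, read on the `M`-lattice against the fixed
second leg `(w, inl β)`, is the real part of a lattice kernel, `K (M•y) w (inr ν) (inl β) = Re latticeKernel (G ν) (y + t)`, then the leg
pushed to the `(M·L)`-lattice is the real part of the coarse lattice kernel of the PUSHED SYMBOL:
`pushSum M L K ((M·L)•z) w (inr μ) (inl β) = Re latticeKernel (pushSym L μ t (G μ)) z`. -/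
theorem pushSum_inr_inl_symbol (K : ExpKernelCalculus.MKer (d + 1) (Fib d)) (w : Fin (d + 1) → ℤ) (β : Fin (d + 1))
    (G : Fin (d + 1) → (Fin (d + 1) → ℂ) → ℂ) (t : Fin (d + 1) → ℤ)
    (hK : ∀ ν y, K ((M : ℤ) • y) w (Sum.inr ν) (Sum.inl β) = (latticeKernel (G ν) (y + t)).re)
    (hper : ∀ ν (i : Fin (d + 1)) (P : Fin (d + 1) → ℂ), G ν (Function.update P i (P i + 2 * π)) = G ν P)
    (hcont : ∀ ν, Continuous fun p : Fin (d + 1) → ℝ => G ν (ofRealVec p)) (μ : Fin (d + 1)) (z : Fin (d + 1) → ℤ) :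
    pushSum M L K (((M * L : ℕ) : ℤ) • z) w (Sum.inr μ) (Sum.inl β) = (latticeKernel (pushSym L μ t (G μ)) z).re := by
  rw [pushSum_inr_inl_coarse]
  have e : (fun ν y => K ((M : ℤ) • y) w (Sum.inr ν) (Sum.inl β)) = fun ν y => (latticeKernel (G ν) (y + t)).re := by
    funext ν y; exact hK ν y
  rw [e, contourSum_re_latticeKernel L G hper hcont t μ z]

/-- [folklore] **THE SYMBOL OF ONE PUSH, field–multiplier entry** (the transposed reading, second leg pushed). -/
theorem pushSum_inl_inr_symbol (K : ExpKernelCalculus.MKer (d + 1) (Fib d)) (x : Fin (d + 1) → ℤ) (α : Fin (d + 1))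
    (G : Fin (d + 1) → (Fin (d + 1) → ℂ) → ℂ) (t : Fin (d + 1) → ℤ)
    (hK : ∀ ν y, K x ((M : ℤ) • y) (Sum.inl α) (Sum.inr ν) = (latticeKernel (G ν) (y + t)).re)
    (hper : ∀ ν (i : Fin (d + 1)) (P : Fin (d + 1) → ℂ), G ν (Function.update P i (P i + 2 * π)) = G ν P)
    (hcont : ∀ ν, Continuous fun p : Fin (d + 1) → ℝ => G ν (ofRealVec p)) (ν : Fin (d + 1)) (z : Fin (d + 1) → ℤ) :
    pushSum M L K x (((M * L : ℕ) : ℤ) • z) (Sum.inl α) (Sum.inr ν) = (latticeKernel (pushSym L ν t (G ν)) z).re := by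
  rw [pushSum_inl_inr_coarse]
  have e : (fun ν' y => K x ((M : ℤ) • y) (Sum.inl α) (Sum.inr ν')) = fun ν' y => (latticeKernel (G ν') (y + t)).re := by
    funext ν' y; exact hK ν' y
  rw [e, contourSum_re_latticeKernel L G hper hcont t ν z]

end Summit.QuantumFields.BalabanUV.Beta.GAN24.PushSumSymbol

end
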